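import Literature.Probability.RandomPlanarGeometry.ConformalRemovabilityHubs
import Literature.Probability.RandomPlanarGeometry.ConformalRemovabilityGenericLine
import Literature.Probability.RandomPlanarGeometry.ConformalRemovabilityPartition
import Mathlib.MeasureTheory.Integral.IntervalIntegral.FundThmCalculus
import HarnessLib

/-!
# Conformal removability: the two-point estimate on a generic line (Jones–Smirnov 2000, Prop. 1)

P. W. Jones, S. K. Smirnov, *Removability theorems for Sobolev functions and quasiconformal maps*,
Ark. Mat. 38 (2000) 263–279, proof of Prop. 1, pp. 270–272, estimate (10):
`|f(xⱼ) - f(yⱼ)| ≤ ∫_{[xⱼ,yⱼ] ∖ K} |∂f| + 2n Σ_{SH(Q) ∩ [xⱼ,yⱼ] ≠ ∅, l(Q) ≤ Δ} |∇f|(Q) l(Q)`,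
"Moreover, only Whitney cubes of size at most `Δ` (which we can choose to be arbitrarily small)
are included in the latter estimate."

Planar conformal version for the boundary `K = ∂Ω` of a Hölder domain, with the Whitney discs
and rays of `WhitneyTree`: for `F` continuous and injective on an open `U ⊇ ∂Ω` and holomorphic
on `U ∖ ∂Ω`, on every *generic* horizontal line `Im z = y` (the costs of the small discs whose
`6τ`-neighbourhood meets the line are summable, `ae_tsum_indicator_lt_top`) and for all boundary
points `u + iy`, `u' + iy` whose segment lies in `U` and carries an integrable `F'`,

  `‖F(u' + iy) - F(u + iy)‖ ≤ ∫_u^{u'} ‖F'(t + iy)‖ dt`        (`twoPoint_of_generic`).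

Proof (pp. 270–272 with the modifications described in `ConformalRemovabilityPartition.lean` and
`ConformalRemovabilityHubs.lean`): given `ε`, let `H₀` be the finite set of large or expensive
discs; every boundary point of the segment is the landing point of a ray whose part after the last
visit to `H₀` starts at a hub `h` (finitely many); points with the same hub have
`‖F(s+iy) - F(t+iy)‖ ≤ 2 Σ_{H₀-free subtree of h, near the line} c(v)` (chains of discs,
`enorm_sub_le_tsum_indicator_of_ray`, and continuity of `F` for the closure), gaps of `K` on the
line are handled by the fundamental theorem of calculus, the partition lemma
`enorm_sub_le_lintegral_add_sum` adds everything up, and the subtrees being disjoint the total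
error is `≤ 2ε`. Finally `ae_twoPoint_horizontal` chooses `δ₀`, `τ`, the costs and the generic
lines.
-/

noncomputable section

open Set Metric MeasureTheory Filter Complex

open scoped NNReal ENNReal Topology

namespace Literature.Probability.RandomPlanarGeometry

variable {Ω : Set ℂ}

namespace WhitneyTree

variable (W : WhitneyTree Ω)

/-- **Landing points of rays are boundary points**: the centres along a ray lie in `Ω` and their
radii `dist(·, Ωᶜ)/100` tend to `0`. [cite: JonesSmirnov2000, §1 p. 267] -/
theorem mem_frontier_of_ray (φ : ConformalEquiv (ball (0 : ℂ) 1) Ω) {C α : ℝ≥0} (hα : 0 < α)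
    (hH : HolderOnWith C α φ (ball (0 : ℂ) 1)) {x : ℕ → W.S}
    (hx : ∀ n, W.parent (x (n + 1)) = x n) (hx0 : ∀ n, x (n + 1) ≠ W.root) {z : ℂ}
    (hz : Tendsto (fun n => (x n : ℂ)) atTop (𝓝 z)) : z ∈ frontier Ω := by
  have hΩo := isOpen_of_conformalEquiv_ball φ
  have hΩc : Ωᶜ.Nonempty := compl_nonempty_of_holderOnWith φ hH
  have hzc : z ∈ closure Ω :=
    mem_closure_of_tendsto hz (Eventually.of_forall fun n => W.isWhitney.subset (x n).2)
  have h0 : Tendsto (fun n => infDist (x n : ℂ) Ωᶜ / 100) atTop (𝓝 0) := by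
    simpa using (W.summable_ray φ hα hH hx hx0 0).tendsto_atTop_zero
  have h1 : Tendsto (fun n => infDist (x n : ℂ) Ωᶜ) atTop (𝓝 (infDist z Ωᶜ)) :=
    ((continuous_infDist_pt (Ωᶜ : Set ℂ)).tendsto z).comp hz
  have h2 : Tendsto (fun n => infDist (x n : ℂ) Ωᶜ) atTop (𝓝 0) := by
    simpa using h0.mul_const 100
  have h3 : infDist z Ωᶜ = 0 := tendsto_nhds_unique h1 h2
  have hzΩ : z ∉ Ω := by
    have : z ∈ closure Ωᶜ := (mem_closure_iff_infDist_zero hΩc).2 h3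
    rw [hΩo.isClosed_compl.closure_eq] at this
    exact this
  rw [frontier, hΩo.interior_eq]
  exact ⟨hzc, hzΩ⟩

/-- The small Whitney discs, dilated `11` times, lie in `U ∖ ∂Ω` as soon as the
`111 δ₀`-neighbourhood of `∂Ω` lies in `U`. [folklore] -/
theorem ball_subset_of_small {U : Set ℂ} (hΩo : IsOpen Ω) (hΩc : Ωᶜ.Nonempty) {δ₀ : ℝ}
    (hδU : cthickening (111 * δ₀) (frontier Ω) ⊆ U) {v : W.S}
    (hv : infDist (v : ℂ) Ωᶜ / 100 < δ₀) :
    ball (v : ℂ) (11 * (infDist (v : ℂ) Ωᶜ / 100)) ⊆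
      (thickening (111 * δ₀) (frontier Ω) \ frontier Ω) ∩ (U \ frontier Ω) := by
  have hvΩ : (v : ℂ) ∈ Ω := W.isWhitney.subset v.2
  have hΩne : Ω ≠ univ := fun h => by
    obtain ⟨p, hp⟩ := hΩc
    exact hp (h ▸ mem_univ p)
  obtain ⟨ξ, hξ, hξd⟩ := exists_mem_frontier_infDist_compl_eq_dist hvΩ hΩne
  intro w hw
  rw [mem_ball] at hw
  have hwΩ : w ∈ Ω := by
    refine ball_infDist_compl_subset (x := (v : ℂ)) (s := Ω) (mem_ball.2 ?_)
    linarith [infDist_nonneg (x := (v : ℂ)) (s := Ωᶜ)]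
  have hwK : w ∉ frontier Ω := fun h => by
    have : w ∈ Ω ∩ frontier Ω := ⟨hwΩ, h⟩
    rw [hΩo.inter_frontier_eq] at this
    exact this
  have hwt : w ∈ thickening (111 * δ₀) (frontier Ω) := by
    rw [mem_thickening_iff]
    refine ⟨ξ, hξ, ?_⟩
    calc dist w ξ ≤ dist w v + dist (v : ℂ) ξ := dist_triangle _ _ _
      _ < 11 * (infDist (v : ℂ) Ωᶜ / 100) + infDist (v : ℂ) Ωᶜ := by rw [← hξd]; linarith
      _ ≤ 111 * δ₀ := by linarith [infDist_nonneg (x := (v : ℂ)) (s := Ωᶜ)]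
  exact ⟨⟨hwt, hwK⟩, hδU (thickening_subset_cthickening _ _ hwt), hwK⟩

/-- **The two-point estimate on a generic horizontal line** (Jones–Smirnov 2000, Prop. 1,
estimate (10), planar conformal case, for `K = ∂Ω` of a Hölder domain). See the module
docstring. The costs are `c(v) = 4 (∫_{B(v, 11 r(v))} ‖F'‖ₑ²)^{1/2}` for the small discs
(`r(v) < δ₀`) and `0` otherwise; `τ` bounds the radii along rays; the line `Im z = y` is generic
in the sense that `Σ_{v : |Im v - y| ≤ 6τ(v)} c(v) < ∞`. [cite: JonesSmirnov2000, Prop. 1 (pp. 270–272, estimate (10))] -/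
theorem twoPoint_of_generic (φ : ConformalEquiv (ball (0 : ℂ) 1) Ω) {C α : ℝ≥0} (hα : 0 < α)
    (hH : HolderOnWith C α φ (ball (0 : ℂ) 1)) {U : Set ℂ} (hU : IsOpen U)
    (hKU : frontier Ω ⊆ U) {F : ℂ → ℂ} (hFc : ContinuousOn F U)
    (hFd : DifferentiableOn ℂ F (U \ frontier Ω)) {δ₀ : ℝ} (hδ₀ : 0 < δ₀)
    (hδU : cthickening (111 * δ₀) (frontier Ω) ⊆ U) {τ : W.S → ℝ}
    (hτ : ∀ x : ℕ → W.S, (∀ n, W.parent (x (n + 1)) = x n) → (∀ n, x (n + 1) ≠ W.root) →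
      ∀ k, ∑' n, infDist (x (k + n) : ℂ) Ωᶜ / 100 ≤ τ (x k))
    {c : W.S → ℝ≥0∞} (hc : ∀ v, c v = {v : W.S | infDist (v : ℂ) Ωᶜ / 100 < δ₀}.indicator
      (fun v => 4 * (∫⁻ w in ball (v : ℂ) (11 * (infDist (v : ℂ) Ωᶜ / 100)),
        ‖deriv F w‖ₑ ^ 2) ^ (1 / 2 : ℝ)) v)
    {y : ℝ} (hy : ∑' v, {v : W.S | |(v : ℂ).im - y| ≤ 6 * τ v}.indicator c v < ∞)
    {u u' : ℝ} (huu' : u ≤ u') (hseg : ∀ t ∈ Icc u u', (t : ℂ) + y * I ∈ U)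
    (hint : IntervalIntegrable (fun t : ℝ => deriv F (t + y * I)) volume u u')
    (huK : (u : ℂ) + y * I ∈ frontier Ω) (hu'K : (u' : ℂ) + y * I ∈ frontier Ω) :
    ‖F (u' + y * I) - F (u + y * I)‖ ≤ ∫ t in u..u', ‖deriv F (t + y * I)‖ := by
  classical
  have hΩo := isOpen_of_conformalEquiv_ball φ
  have hΩc : Ωᶜ.Nonempty := compl_nonempty_of_holderOnWith φ hH
  have hΩb := isBounded_of_holderOnWith φ hH
  set K := frontier Ω with hK
  have hKc : IsClosed K := isClosed_frontier
  set small : Set W.S := {v : W.S | infDist (v : ℂ) Ωᶜ / 100 < δ₀} with hsmall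
  set Rel : Set W.S := {v : W.S | |(v : ℂ).im - y| ≤ 6 * τ v} with hRel
  set f : ℝ → ℂ := fun t => F (t + y * I) with hf
  set g : ℝ → ℝ≥0∞ := fun t => ‖deriv F (t + y * I)‖ₑ with hg
  -- small discs lie in `U \ K`; the edge estimate
  have hballU : ∀ v : W.S, v ∈ small → ball (v : ℂ) (11 * (infDist (v : ℂ) Ωᶜ / 100)) ⊆ U \ K :=
    fun v hv => (W.ball_subset_of_small hΩo hΩc hδU hv).trans inter_subset_right
  have hmemU : ∀ v : W.S, v ∈ small → (v : ℂ) ∈ U := fun v hv =>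
    (hballU v hv (mem_ball_self (by
      have := infDist_compl_pos hΩo hΩc (W.isWhitney.subset v.2); positivity))).1
  have hedge : ∀ v : W.S, v ∈ small → v ≠ W.root → ‖F (W.parent v) - F v‖ₑ ≤ c v := by
    intro v hv hvr
    rw [hc v, Set.indicator_of_mem hv]
    exact W.enorm_sub_parent_le hvr (infDist_compl_pos hΩo hΩc (W.isWhitney.subset v.2))
      (hFd.mono (hballU v hv))
  -- continuity of `f` at points over `U`
  have hfcont : ∀ t : ℝ, (t : ℂ) + y * I ∈ U → ContinuousAt f t := fun t ht => by
    have h1 : ContinuousAt (fun t : ℝ => (t : ℂ) + y * I) t := by fun_prop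
    show ContinuousAt (F ∘ fun t : ℝ => (t : ℂ) + y * I) t
    exact ContinuousAt.comp (hFc.continuousAt (hU.mem_nhds ht)) h1
  -- reduction to an estimate with an arbitrary error
  suffices key : ∀ ε : ℝ≥0∞, ε ≠ 0 → ‖f u' - f u‖ₑ ≤ (∫⁻ t in Ioc u u', g t) + 2 * ε by
    have hlin : ∫⁻ t in Ioc u u', g t = ENNReal.ofReal (∫ t in u..u', ‖deriv F (t + y * I)‖) := by
      rw [intervalIntegral.integral_of_le huu', ofReal_integral_norm_eq_lintegral_enorm hint.1]
    have h1 : ‖f u' - f u‖ₑ ≤ ∫⁻ t in Ioc u u', g t := by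
      refine ENNReal.le_of_forall_pos_le_add fun ε hε _ => ?_
      have h := key ((ε : ℝ≥0∞) / 2) (by simp [hε.ne'])
      rwa [ENNReal.mul_div_cancel (by norm_num) (by norm_num)] at h
    rw [hlin, ← ofReal_norm] at h1
    exact (ENNReal.ofReal_le_ofReal_iff (intervalIntegral.integral_nonneg huu'
      fun t _ => norm_nonneg _)).1 h1
  intro ε hε
  -- (1) the finite set of expensive discs near the line, and `H₀`
  obtain ⟨Fε, hFε⟩ := exists_finset_tsum_indicator_compl_le hy.ne hε
  have hbig : smallᶜ.Finite := by
    have := W.finite_setOf_le hΩb hδ₀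
    refine this.subset fun v hv => ?_
    simpa only [hsmall, mem_compl_iff, mem_setOf_eq, not_lt] using hv
  set H₀ : Finset W.S := Fε ∪ hbig.toFinset ∪ {W.root} with hH₀
  have hroot : W.root ∈ H₀ := by simp [hH₀]
  have hH₀small : ∀ v, v ∉ H₀ → v ∈ small := by
    intro v hv
    by_contra h
    exact hv (by simp [hH₀, hbig.mem_toFinset, h])
  have hH₀F : ∀ v, v ∉ H₀ → v ∈ ((↑Fε : Set W.S)ᶜ) := by
    intro v hv h
    exact hv (by simp [hH₀, Finset.mem_coe.1 h])
  have hH₀root : ∀ v, v ∉ H₀ → v ≠ W.root := by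
    rintro v hv rfl
    exact hv hroot
  -- (2) subtrees, shadows on the line, per-hub constants
  set Sub : W.S → Set W.S := fun h =>
    {w : W.S | ∃ m, W.parent^[m] w = h ∧ ∀ i ≤ m, W.parent^[i] w ∉ H₀} with hSub
  set A₀ : W.S → Set ℝ := fun h => {t : ℝ | ∃ x : ℕ → W.S, x 0 = h ∧
    (∀ n, W.parent (x (n + 1)) = x n) ∧ (∀ n, x (n + 1) ≠ W.root) ∧ (∀ n, x n ∉ H₀) ∧
    Tendsto (fun n => (x n : ℂ)) atTop (𝓝 ((t : ℂ) + y * I))} with hA₀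
  set Cst : W.S → ℝ≥0∞ := fun h => 2 * ∑' v, (Sub h ∩ Rel).indicator c v with hCst
  have hA₀K : ∀ h t, t ∈ A₀ h → (t : ℂ) + y * I ∈ K := by
    rintro h t ⟨x, -, hx, hx0, -, hxz⟩
    exact W.mem_frontier_of_ray φ hα hH hx hx0 hxz
  have hAK : ∀ h t, t ∈ closure (A₀ h) → (t : ℂ) + y * I ∈ K := by
    intro h
    have hcl : IsClosed {t : ℝ | (t : ℂ) + y * I ∈ K} :=
      hKc.preimage (continuous_ofReal.add continuous_const)
    exact fun t ht => closure_minimal (fun s hs => hA₀K h s hs) hcl ht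
  -- (3) the chain estimate along a ray from a hub
  have hray : ∀ h t, t ∈ A₀ h → ‖F h - f t‖ₑ ≤ ∑' v, (Sub h ∩ Rel).indicator c v := by
    rintro h t ⟨x, hx0h, hx, hx0, hxH, hxz⟩
    have hzK := W.mem_frontier_of_ray φ hα hH hx hx0 hxz
    have hedge' : ∀ n, ‖F (x n) - F (x (n + 1))‖ₑ ≤ c (x (n + 1)) := fun n => by
      rw [← hx n]
      exact hedge _ (hH₀small _ (hxH _)) (hx0 n)
    have hT : ∀ n, x (n + 1) ∈ Sub h ∩ Rel := fun n =>
      ⟨W.ray_mem_subtree hx0h hx hxH (n + 1), by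
        have := W.abs_im_sub_le_of_ray φ hα hH hτ hx hx0 hxz (n + 1)
        simpa [hRel] using this⟩
    have hFz : Tendsto (fun n => F (x n)) atTop (𝓝 (F ((t : ℂ) + y * I))) := by
      have hcw : ContinuousWithinAt F U ((t : ℂ) + y * I) := hFc _ (hKU hzK)
      refine hcw.tendsto.comp (tendsto_nhdsWithin_iff.2 ⟨hxz, Eventually.of_forall fun n => ?_⟩)
      exact hmemU _ (hH₀small _ (hxH n))
    have := W.enorm_sub_le_tsum_indicator_of_ray hx hx0 hedge' hT hFz
    rwa [hx0h] at this
  -- (4) oscillation on the closed shadows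
  have htri : ∀ a b e : ℂ, ‖a - b‖ₑ ≤ ‖e - a‖ₑ + ‖e - b‖ₑ := fun a b e => by
    have := edist_triangle_left a b e
    simpa only [edist_eq_enorm_sub] using this
  have hC₀ : ∀ h, ∀ s ∈ A₀ h, ∀ t ∈ A₀ h, ‖f t - f s‖ₑ ≤ Cst h := by
    intro h s hs t ht
    calc ‖f t - f s‖ₑ ≤ ‖F h - f t‖ₑ + ‖F h - f s‖ₑ := htri _ _ _
      _ ≤ (∑' v, (Sub h ∩ Rel).indicator c v) + ∑' v, (Sub h ∩ Rel).indicator c v :=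
          add_le_add (hray h t ht) (hray h s hs)
      _ = Cst h := by simp only [hCst]; ring
  have hC : ∀ h, ∀ s ∈ closure (A₀ h), ∀ t ∈ closure (A₀ h), ‖f t - f s‖ₑ ≤ Cst h := by
    intro h s hs t ht
    obtain ⟨sq, hsq, hsql⟩ := mem_closure_iff_seq_limit.1 hs
    obtain ⟨tq, htq, htql⟩ := mem_closure_iff_seq_limit.1 ht
    have hfs : Tendsto (fun k => f (sq k)) atTop (𝓝 (f s)) :=
      (hfcont s (hKU (hAK h s hs))).tendsto.comp hsql
    have hft : Tendsto (fun k => f (tq k)) atTop (𝓝 (f t)) :=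
      (hfcont t (hKU (hAK h t ht))).tendsto.comp htql
    have hlim : Tendsto (fun k => ‖f (tq k) - f (sq k)‖ₑ) atTop (𝓝 ‖f t - f s‖ₑ) :=
      (hft.sub hfs).enorm
    exact le_of_tendsto' hlim fun k => hC₀ h _ (hsq k) _ (htq k)
  -- (5) the gap estimate (fundamental theorem of calculus off `K`)
  set Kl : Set ℝ := {t : ℝ | t ∈ Icc u u' ∧ (t : ℂ) + y * I ∈ K} with hKl
  have hKlc : IsClosed Kl := isClosed_Icc.inter (hKc.preimage (continuous_ofReal.add continuous_const))
  have hgap : ∀ a b, a ≤ b → a ∈ Kl → b ∈ Kl → (∀ t ∈ Ioo a b, t ∉ Kl) →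
      ‖f b - f a‖ₑ ≤ ∫⁻ t in Ioc a b, g t := by
    intro a b hab ha hb hno
    have hsub : Icc a b ⊆ Icc u u' := Icc_subset_Icc ha.1.1 hb.1.2
    have hcont : ContinuousOn f (Icc a b) := fun t ht =>
      (hfcont t (hseg t (hsub ht))).continuousWithinAt
    have hderiv : ∀ t ∈ Ioo a b, HasDerivAt f (deriv F (t + y * I)) t := by
      intro t ht
      have htI : t ∈ Icc u u' := hsub (Ioo_subset_Icc_self ht)
      have htK : (t : ℂ) + y * I ∉ K := fun h => hno t ht ⟨htI, h⟩
      have htU : (t : ℂ) + y * I ∈ U \ K := ⟨hseg t htI, htK⟩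
      have hFt : HasDerivAt F (deriv F (t + y * I)) (t + y * I) :=
        (hFd.differentiableAt ((hU.sdiff hKc).mem_nhds htU)).hasDerivAt
      exact (HasDerivAt.comp_add_const (t : ℂ) (y * I) hFt).comp_ofReal
    have hint' : IntervalIntegrable (fun t : ℝ => deriv F (t + y * I)) volume a b := by
      refine hint.mono_set ?_
      rw [uIcc_of_le huu', uIcc_of_le hab]
      exact hsub
    have hftc := intervalIntegral.integral_eq_sub_of_hasDerivAt_of_le hab hcont hderiv hint'
    have h1 : ‖f b - f a‖ ≤ ∫ t in a..b, ‖deriv F (t + y * I)‖ := by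
      rw [← hftc]
      exact intervalIntegral.norm_integral_le_integral_norm hab
    calc ‖f b - f a‖ₑ = ENNReal.ofReal ‖f b - f a‖ := (ofReal_norm _).symm
      _ ≤ ENNReal.ofReal (∫ t in a..b, ‖deriv F (t + y * I)‖) := ENNReal.ofReal_le_ofReal h1
      _ = ∫⁻ t in Ioc a b, g t := by
          rw [intervalIntegral.integral_of_le hab, ofReal_integral_norm_eq_lintegral_enorm hint'.1]
  -- (6) the hubs form a finite set covering `Kl`
  have hHubs : {h : W.S | h ∉ H₀ ∧ W.parent h ∈ H₀}.Finite := by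
    refine (H₀.finite_toSet.biUnion fun p _ => W.finite_children p).subset ?_
    rintro h ⟨hh, hp⟩
    exact mem_iUnion₂.2 ⟨W.parent h, Finset.mem_coe.2 hp, rfl, hH₀root h hh⟩
  set Hubs : Finset W.S := hHubs.toFinset with hHubsdef
  have hcov : ∀ t ∈ Kl, u ≤ t → ∃ h ∈ Hubs, t ∈ closure (A₀ h) := by
    rintro t ⟨-, htK⟩ -
    obtain ⟨x, hx0r, hx, hx0, hxz⟩ := W.exists_ray_tendsto_of_mem_frontier φ hα hH htK
    obtain ⟨h, yv, hhH, hph, hy0, hyv, hyv0, hyH, hyz⟩ :=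
      W.exists_hub_of_ray hroot hx0r hx hx0 hxz
    have hmem : h ∈ Hubs := hHubs.mem_toFinset.2 ⟨hhH, hph⟩
    have htA : t ∈ A₀ h := ⟨yv, hy0, hyv, hyv0, hyH, hyz⟩
    exact ⟨h, hmem, subset_closure htA⟩
  -- (7) the partition lemma
  have main := enorm_sub_le_lintegral_add_sum (f := f) (g := g) hKlc (u' := u')
    ⟨right_mem_Icc.2 huu', hu'K⟩ (fun t ht => ht.1.2) (A := fun h => closure (A₀ h))
    (fun h => isClosed_closure) (C := Cst) hC hgap Hubs (u := u) ⟨left_mem_Icc.2 huu', huK⟩ hcov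
  -- (8) the hubs' subtrees are disjoint: the total is `≤ 2ε`
  have hmemSub : ∀ h v, v ∈ Sub h → v ∉ H₀ := by
    rintro h v ⟨m, -, hm⟩
    simpa using hm 0 (Nat.zero_le _)
  have hpt : ∀ v, ∑ h ∈ Hubs, (Sub h ∩ Rel).indicator c v ≤
      ((↑Fε : Set W.S)ᶜ).indicator (Rel.indicator c) v := by
    intro v
    by_cases hv : ∃ h ∈ Hubs, v ∈ Sub h
    · obtain ⟨h, hh, hvh⟩ := hv
      rw [Finset.sum_eq_single_of_mem h hh]
      · by_cases hvR : v ∈ Rel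
        · rw [Set.indicator_of_mem (show v ∈ Sub h ∩ Rel from ⟨hvh, hvR⟩),
            Set.indicator_of_mem (hH₀F v (hmemSub h v hvh)), Set.indicator_of_mem hvR]
        · rw [Set.indicator_of_notMem (show v ∉ Sub h ∩ Rel from fun h' => hvR h'.2)]
          exact bot_le
      · intro h' hh' hne
        refine Set.indicator_of_notMem (fun hv' => hne ?_) _
        obtain ⟨m, hm, hmH⟩ := hv'.1
        obtain ⟨m', hm', hm'H⟩ := hvh
        have h1 := (hHubs.mem_toFinset.1 hh').2
        have h2 := (hHubs.mem_toFinset.1 hh).2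
        exact W.subtree_disjoint h1 h2 hm hmH hm' hm'H
    · push Not at hv
      rw [Finset.sum_eq_zero fun h hh => Set.indicator_of_notMem (fun hv' => hv h hh hv'.1) _]
      exact bot_le
  have hsum : ∑ h ∈ Hubs, Cst h ≤ 2 * ε := by
    simp only [hCst]
    rw [← Finset.mul_sum]
    gcongr
    calc ∑ h ∈ Hubs, ∑' v, (Sub h ∩ Rel).indicator c v
        = ∑' v, ∑ h ∈ Hubs, (Sub h ∩ Rel).indicator c v :=
          (Summable.tsum_finsetSum fun _ _ => ENNReal.summable).symm
      _ ≤ ∑' v, ((↑Fε : Set W.S)ᶜ).indicator (Rel.indicator c) v := ENNReal.tsum_le_tsum hpt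
      _ ≤ ε := hFε
  calc ‖f u' - f u‖ₑ ≤ (∫⁻ t in Ioc u u', g t) + ∑ h ∈ Hubs, Cst h := main
    _ ≤ (∫⁻ t in Ioc u u', g t) + 2 * ε := add_le_add le_rfl hsum

end WhitneyTree

/-! ### Almost every horizontal line -/

/-- **The two-point estimate on almost every horizontal line** (Jones–Smirnov 2000, Prop. 1,
planar conformal case): for the boundary `∂Ω` of a Hölder domain, `F` continuous and injective
on an open `U ⊇ ∂Ω` and holomorphic on `U ∖ ∂Ω`, for a.e. `y`: for all boundary points
`u + iy`, `u' + iy` (`u ≤ u'`) whose segment lies in `U` and on which `F'` is integrable,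
`‖F(u' + iy) - F(u + iy)‖ ≤ ∫_u^{u'} ‖F'(t + iy)‖ dt`. [cite: JonesSmirnov2000, Prop. 1 (pp. 270–272)] -/
theorem ae_twoPoint_horizontal (φ : ConformalEquiv (ball (0 : ℂ) 1) Ω) {C α : ℝ≥0} (hα : 0 < α)
    (hH : HolderOnWith C α φ (ball (0 : ℂ) 1)) {U : Set ℂ} (hU : IsOpen U)
    (hKU : frontier Ω ⊆ U) {F : ℂ → ℂ} (hFc : ContinuousOn F U) (hFi : InjOn F U)
    (hFd : DifferentiableOn ℂ F (U \ frontier Ω)) :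
    ∀ᵐ y : ℝ, ∀ u u' : ℝ, u ≤ u' → (∀ t ∈ Icc u u', (t : ℂ) + y * I ∈ U) →
      IntervalIntegrable (fun t : ℝ => deriv F (t + y * I)) volume u u' →
      (u : ℂ) + y * I ∈ frontier Ω → (u' : ℂ) + y * I ∈ frontier Ω →
      ‖F (u' + y * I) - F (u + y * I)‖ ≤ ∫ t in u..u', ‖deriv F (t + y * I)‖ := by
  classical
  obtain ⟨W⟩ := WhitneyTree.nonempty_of_holderOnWith φ hα hH
  have hΩo := isOpen_of_conformalEquiv_ball φ
  have hΩc : Ωᶜ.Nonempty := compl_nonempty_of_holderOnWith φ hH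
  have hΩb := isBounded_of_holderOnWith φ hH
  set K := frontier Ω with hK
  have hKcpt : IsCompact K :=
    Metric.isCompact_of_isClosed_isBounded isClosed_frontier
      (hΩb.closure.subset frontier_subset_closure)
  obtain ⟨δ, hδ, hδU⟩ := hKcpt.exists_cthickening_subset_open hU hKU
  set δ₀ : ℝ := δ / 111 with hδ₀
  have hδ₀0 : 0 < δ₀ := by positivity
  have hδU' : cthickening (111 * δ₀) K ⊆ U := by
    rw [show 111 * δ₀ = δ by rw [hδ₀]; ring]
    exact hδU
  obtain ⟨τ, hτ0, -, hτ, hτs⟩ := W.exists_tau φ hα hH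
  haveI : Countable W.S := W.isWhitney.countable.to_subtype
  set small : Set W.S := {v : W.S | infDist (v : ℂ) Ωᶜ / 100 < δ₀} with hsmall
  set J : W.S → ℝ≥0∞ := fun v =>
    ∫⁻ w in ball (v : ℂ) (11 * (infDist (v : ℂ) Ωᶜ / 100)), ‖deriv F w‖ₑ ^ 2 with hJ
  set c : W.S → ℝ≥0∞ := small.indicator fun v => 4 * J v ^ (1 / 2 : ℝ) with hc
  -- the costs are square summable
  set O : Set ℂ := thickening (111 * δ₀) K \ K with hO
  have hOo : IsOpen O := isOpen_thickening.sdiff isClosed_frontier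
  have hOU : O ⊆ U \ K := fun w hw => ⟨hδU' (thickening_subset_cthickening _ _ hw.1), hw.2⟩
  have hvolO : volume (F '' O) ≠ ∞ := by
    have hcpt : IsCompact (F '' cthickening (111 * δ₀) K) :=
      (hKcpt.cthickening).image_of_continuousOn (hFc.mono hδU')
    exact ne_top_of_le_ne_top hcpt.measure_lt_top.ne
      (measure_mono (image_mono fun w hw => thickening_subset_cthickening _ _ hw.1))
  have hc2 : ∑' v, c v ^ 2 ≠ ∞ := by
    have h1 : ∀ v, c v ^ 2 = 16 * small.indicator J v := by
      intro v
      by_cases hv : v ∈ small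
      · simp only [hc, Set.indicator_of_mem hv]
        have h2 : (J v ^ (1 / 2 : ℝ)) ^ (2 : ℕ) = J v := by
          rw [← ENNReal.rpow_natCast, ← ENNReal.rpow_mul]
          norm_num
        rw [mul_pow, h2]
        norm_num
      · simp only [hc, Set.indicator_of_notMem hv]
        simp
    simp_rw [h1]
    rw [ENNReal.tsum_mul_left]
    refine ENNReal.mul_ne_top (by norm_num) (ne_top_of_le_ne_top ?_
      (tsum_indicator_setLIntegral_ball_le W hΩo hΩc
        ((measurable_deriv F).enorm.pow_const 2).aemeasurable hOo.measurableSet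
        fun v hv => (W.ball_subset_of_small hΩo hΩc hδU' hv).trans inter_subset_left))
    rw [lintegral_enorm_deriv_sq_eq_volume_image hOo (hFd.mono hOU) (hFi.mono fun w hw =>
      (hOU hw).1)]
    exact ENNReal.mul_ne_top ENNReal.ofReal_ne_top hvolO
  have hgen := ae_tsum_indicator_lt_top (fun v : W.S => (v : ℂ).im) hτ0 hτs hc2
  filter_upwards [hgen] with y hy
  intro u u' huu' hseg hint huK hu'K
  exact W.twoPoint_of_generic φ hα hH hU hKU hFc hFd hδ₀0 hδU' hτ (c := c) (fun v => rfl) hy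
    huu' hseg hint huK hu'K

end Literature.Probability.RandomPlanarGeometry
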